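import Literature.InformationTheory.Entropy.ConditionalEntropyConcavity
import Literature.LinearAlgebra.Matrix.JordanFormPolynomials
import Mathlib.LinearAlgebra.Matrix.Charpoly.Basic
import Mathlib.Data.Matrix.Block
import HarnessLib

/-!
# Von Neumann entropy of matrices with restricted support: compression to the support, fibrewise
# block structure, and mixtures of states with pairwise orthogonal (label-separated) supports

Topic `Literature/InformationTheory/Entropy` (namespace = path). Elementary spectral bookkeeping for the
entropy `S(ρ) = Σ η(λ)` (`vonNeumannEntropy`, `η = Real.negMulLog`) of Hermitian matrices over `ℂ` whose
entries vanish outside prescribed index classes — the finite-dimensional facts behind «the entropy of a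
state supported in a symmetry sector equals the entropy of its compression» and Nielsen–Chuang's
`S(Σ_x p_x ρ_x) = H(p) + Σ_x p_x S(ρ_x)` for states `ρ_x` with support on ORTHOGONAL subspaces
[cite: NielsenChuang2010, §11.3.5 eq. (11.83) p.517; Theorem 11.8 (4) p.513]:

* §1 SUPPORT: `vonNeumannEntropy_fromBlocks_zero` (`S(A ⊕ D) = S(A) + S(D)`), `vonNeumannEntropy_zero`,
  **`vonNeumannEntropy_eq_submatrix_of_support`** — if `ρ_{ij} = 0` whenever `¬ p j` then
  `S(ρ) = S(ρ|_p)` (`ρ|_p = ρ.submatrix val val` on `{i // p i}`); the companion trace identities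
  `trace_submatrix_of_support`, `trace_submatrix_mul_submatrix_of_support` (`tr(ρ|_p · A|_p) = tr(ρA)`) and
  `posSemidef`/`trace` transport — what a Gibbs variational bound on a compressed Hamiltonian consumes;
* §2 FIBRES of a labelling `f : n → X`: `vonNeumannEntropy_blockDiagonal'` (dependent direct sums; the
  non-dependent `vonNeumannEntropy_blockDiagonal` is in `ConditionalEntropyConcavity`) and
  **`vonNeumannEntropy_eq_sum_fibers`** — if `ρ_{ij} = 0` whenever `f i ≠ f j` then `S(ρ) = Σ_x S(ρ|_{f = x})`;
* §3 ORTHOGONAL MIXTURES: **`vonNeumannEntropy_sum_of_orthogonalSupports`** — for Hermitian `τ_x` supported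
  on the fibre `f = x`, `S(Σ_x τ_x) = Σ_x S(τ_x)`; with `τ_x = p_x ρ_x`, `tr ρ_x = 1`:
  `S(Σ_x p_x ρ_x) = Σ_x (p_x S(ρ_x) + η(p_x))` (`…_sum_smul_…`), and the UNIFORM mixture over a finite
  set `T` of labels: `S((1/|T|) Σ_{x∈T} ρ_x) = (Σ_{x∈T} S(ρ_x))/|T| + log |T|`
  (`vonNeumannEntropy_uniformMixture_of_orthogonalSupports`) — the mixing entropy of a type class of
  product trial states (consumer: the dressed type-class Gibbs variational bound of the Hubbard
  `T > 0` certificate family, sr-mbsolver/hubbard-thermal C3).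

Everything is PROVED; no definition, no named fact. Proof device throughout: the entropy is a function of
the characteristic polynomial (`vonNeumannEntropy_eq_sum_roots_charpoly`, `vonNeumannEntropy_submatrix_equiv`),
and after reindexing along `Equiv.sumCompl p` / `Equiv.sigmaFiberEquiv f` a support-restricted matrix is
`fromBlocks A 0 0 0` / `blockDiagonal'` (`Matrix.charpoly_fromBlocks_zero₁₂`,
`Literature.LinearAlgebra.Matrix.charpoly_blockDiagonal'`).

## Mathlib / tree search

Tree (REUSED): `vonNeumannEntropy_eq_sum_roots_charpoly`, `vonNeumannEntropy_submatrix_equiv`,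
`vonNeumannEntropy_eq` (`VonNeumannEntropy(Inequalities)`), `vonNeumannEntropy_smul`,
`vonNeumannEntropy_blockDiagonal` (`ConditionalEntropyConcavity`), `charpoly_blockDiagonal'`
(`Literature.LinearAlgebra.Matrix.JordanFormPolynomials`). Mathlib: `Equiv.sumCompl`, `Equiv.sigmaFiberEquiv`,
`Matrix.charpoly_fromBlocks_zero₁₂`, `Matrix.IsHermitian.eigenvalues_eq_zero_iff`, `Polynomial.roots_mul/_prod`,
`Fintype.sum_subtype_add_sum_subtype`. `lean search 'vonNeumannEntropy.*(support|fiber|orthog)'`: nothing.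
-/

namespace Literature.InformationTheory.Entropy

open Matrix Polynomial
open scoped BigOperators ComplexOrder

/-! ### §1 Support: compression to a class of indices -/

section Support

variable {n : Type*} [Fintype n] [DecidableEq n]

/-- **`S(A ⊕ D) = S(A) + S(D)`** for Hermitian diagonal blocks (the characteristic polynomial of
`fromBlocks A 0 0 D` is the product). [cite: NielsenChuang2010, §11.3.5 eq. (11.83) p.517] -/
theorem vonNeumannEntropy_fromBlocks_zero {l m : Type*} [Fintype l] [DecidableEq l] [Fintype m] [DecidableEq m]
    {A : Matrix l l ℂ} {D : Matrix m m ℂ} (hA : A.IsHermitian) (hD : D.IsHermitian) :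
    vonNeumannEntropy (Matrix.fromBlocks A 0 0 D) = vonNeumannEntropy A + vonNeumannEntropy D := by
  have hH : (Matrix.fromBlocks A 0 0 D).IsHermitian :=
    hA.fromBlocks (by rw [Matrix.conjTranspose_zero]) hD
  rw [vonNeumannEntropy_eq_sum_roots_charpoly hH, Matrix.charpoly_fromBlocks_zero₁₂,
    Polynomial.roots_mul (mul_ne_zero (Matrix.charpoly_monic A).ne_zero (Matrix.charpoly_monic D).ne_zero),
    Multiset.map_add, Multiset.sum_add, ← vonNeumannEntropy_eq_sum_roots_charpoly hA,
    ← vonNeumannEntropy_eq_sum_roots_charpoly hD]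

/-- `S(0) = 0`. [cite: NielsenChuang2010, §11.3 eq. (11.40)] -/
theorem vonNeumannEntropy_zero {m : Type*} [Fintype m] [DecidableEq m] :
    vonNeumannEntropy (0 : Matrix m m ℂ) = 0 := by
  have h0 : (0 : Matrix m m ℂ).IsHermitian := Matrix.isHermitian_zero
  rw [vonNeumannEntropy_eq h0]
  have h : h0.eigenvalues = 0 := h0.eigenvalues_eq_zero_iff.2 rfl
  simp [h]

omit [Fintype n] [DecidableEq n] in
/-- A Hermitian matrix whose columns outside `p` vanish also has vanishing rows outside `p`
(`a_{ij} = conj a_{ji}`). [cite: HornJohnson2013, §4.1 Definition 4.1.1] -/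
theorem apply_eq_zero_of_support_left (p : n → Prop) {ρ : Matrix n n ℂ} (hρ : ρ.IsHermitian)
    (hsupp : ∀ i j, ¬ p j → ρ i j = 0) (i j : n) (hi : ¬ p i) : ρ i j = 0 := by
  rw [← hρ.apply i j, hsupp j i hi, star_zero]

/-- **The entropy of a matrix supported on a class of indices is the entropy of its compression**:
if `ρ_{ij} = 0` whenever `¬ p j` (`ρ` Hermitian), then `S(ρ) = S(ρ.submatrix val val)` on `{i // p i}`.
(Reindex along `Equiv.sumCompl p`: `ρ ≃ ρ|_p ⊕ 0`.) [cite: NielsenChuang2010, Theorem 11.8 (4) p.513] -/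
theorem vonNeumannEntropy_eq_submatrix_of_support (p : n → Prop) [DecidablePred p] {ρ : Matrix n n ℂ}
    (hρ : ρ.IsHermitian) (hsupp : ∀ i j, ¬ p j → ρ i j = 0) :
    vonNeumannEntropy ρ =
      vonNeumannEntropy (ρ.submatrix (Subtype.val : {i // p i} → n) Subtype.val) := by
  have hsupp' := apply_eq_zero_of_support_left p hρ hsupp
  set e := Equiv.sumCompl p with he
  have hblock : ρ.submatrix e e =
      Matrix.fromBlocks (ρ.submatrix (Subtype.val : {i // p i} → n) Subtype.val) 0 0
        (0 : Matrix {i // ¬ p i} {i // ¬ p i} ℂ) := by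
    refine Matrix.ext fun a b => ?_
    rcases a with i | i <;> rcases b with j | j
    · rw [Matrix.fromBlocks_apply₁₁, submatrix_apply, submatrix_apply, he, Equiv.sumCompl_apply_inl,
        Equiv.sumCompl_apply_inl]
    · rw [Matrix.fromBlocks_apply₁₂, submatrix_apply, he, Equiv.sumCompl_apply_inl,
        Equiv.sumCompl_apply_inr, Matrix.zero_apply]
      exact hsupp _ _ j.2
    · rw [Matrix.fromBlocks_apply₂₁, submatrix_apply, he, Equiv.sumCompl_apply_inr,
        Equiv.sumCompl_apply_inl, Matrix.zero_apply]
      exact hsupp' _ _ i.2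
    · rw [Matrix.fromBlocks_apply₂₂, submatrix_apply, he, Equiv.sumCompl_apply_inr,
        Equiv.sumCompl_apply_inr, Matrix.zero_apply]
      exact hsupp _ _ j.2
  rw [← vonNeumannEntropy_submatrix_equiv hρ e, hblock,
    vonNeumannEntropy_fromBlocks_zero (hρ.submatrix _) Matrix.isHermitian_zero, vonNeumannEntropy_zero,
    add_zero]

omit [DecidableEq n] in
/-- The compression of a supported matrix has the same trace (the diagonal entries outside the support
vanish). [cite: HornJohnson2013, §0.7.1 (partitioned matrices and principal submatrices)] -/
theorem trace_submatrix_of_support (p : n → Prop) [DecidablePred p] {ρ : Matrix n n ℂ}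
    (hsupp : ∀ i j, ¬ p j → ρ i j = 0) :
    (ρ.submatrix (Subtype.val : {i // p i} → n) Subtype.val).trace = ρ.trace := by
  simp only [Matrix.trace, Matrix.diag, submatrix_apply]
  rw [← Fintype.sum_subtype_add_sum_subtype p (fun i => ρ i i)]
  have h0 : ∑ i : {x // ¬ p x}, ρ i i = 0 := Finset.sum_eq_zero fun i _ => hsupp _ _ i.2
  rw [h0, add_zero]

omit [DecidableEq n] in
/-- **`tr(ρ|_p · A|_p) = tr(ρ A)`** for `ρ` supported on the class `p` (both rows and columns): conformal
partitioned multiplication with three zero blocks. [cite: HornJohnson2013, §0.7.2 (partitioned multiplication)] -/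
theorem trace_submatrix_mul_submatrix_of_support (p : n → Prop) [DecidablePred p] {ρ : Matrix n n ℂ}
    (A : Matrix n n ℂ) (hr : ∀ i j, ¬ p j → ρ i j = 0) (hl : ∀ i j, ¬ p i → ρ i j = 0) :
    (ρ.submatrix (Subtype.val : {i // p i} → n) Subtype.val *
        A.submatrix (Subtype.val : {i // p i} → n) Subtype.val).trace = (ρ * A).trace := by
  have lhs : (ρ.submatrix (Subtype.val : {i // p i} → n) Subtype.val *
        A.submatrix (Subtype.val : {i // p i} → n) Subtype.val).trace =
      ∑ i : {x // p x}, ∑ j : {x // p x}, ρ i j * A j i := by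
    simp only [Matrix.trace, Matrix.diag]
    rfl
  have rhs : (ρ * A).trace = ∑ i, ∑ j, ρ i j * A j i := by
    simp only [Matrix.trace, Matrix.diag, Matrix.mul_apply]
  rw [lhs, rhs, ← Fintype.sum_subtype_add_sum_subtype p (fun i => ∑ j, ρ i j * A j i)]
  have h0 : ∑ i : {x // ¬ p x}, ∑ j, ρ i j * A j i = 0 :=
    Finset.sum_eq_zero fun i _ => Finset.sum_eq_zero fun j _ => by rw [hl _ _ i.2, zero_mul]
  rw [h0, add_zero]
  refine Finset.sum_congr rfl fun i _ => ?_
  rw [← Fintype.sum_subtype_add_sum_subtype p (fun j => ρ i j * A j i)]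
  have h1 : ∑ j : {x // ¬ p x}, ρ i j * A j i = 0 :=
    Finset.sum_eq_zero fun j _ => by rw [hr _ _ j.2, zero_mul]
  rw [h1, add_zero]

omit [Fintype n] [DecidableEq n] in
/-- A principal submatrix of a positive semidefinite matrix is positive semidefinite.
[cite: HornJohnson2013, Observation 7.1.2] -/
theorem posSemidef_submatrix_val (p : n → Prop) {ρ : Matrix n n ℂ} (hρ : ρ.PosSemidef) :
    (ρ.submatrix (Subtype.val : {i // p i} → n) Subtype.val).PosSemidef :=
  hρ.submatrix _

end Support

/-! ### §2 Fibres of a labelling: the dependent block-diagonal structure -/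

section Fibers

variable {n : Type*} [Fintype n] [DecidableEq n] {X : Type*} [Fintype X] [DecidableEq X]

/-- **Entropy of a dependent direct sum**: `S(⊕_x τ_x) = Σ_x S(τ_x)` for Hermitian blocks of possibly
different sizes (`Literature.LinearAlgebra.Matrix.charpoly_blockDiagonal'`).
[cite: NielsenChuang2010, §11.3.5 eq. (11.83) p.517] -/
theorem vonNeumannEntropy_blockDiagonal' {m' : X → Type*} [∀ x, Fintype (m' x)] [∀ x, DecidableEq (m' x)]
    {τ : ∀ x, Matrix (m' x) (m' x) ℂ} (hτ : ∀ x, (τ x).IsHermitian) :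
    vonNeumannEntropy (blockDiagonal' τ) = ∑ x, vonNeumannEntropy (τ x) := by
  have hH : (blockDiagonal' τ).IsHermitian := by
    unfold Matrix.IsHermitian
    rw [Matrix.blockDiagonal'_conjTranspose]
    congr 1
    funext x
    exact hτ x
  rw [vonNeumannEntropy_eq_sum_roots_charpoly hH, Literature.LinearAlgebra.Matrix.charpoly_blockDiagonal',
    Polynomial.roots_prod _ _
      (Finset.prod_ne_zero_iff.mpr fun x _ => (Matrix.charpoly_monic (τ x)).ne_zero),
    Multiset.map_bind, Multiset.sum_bind, ← Finset.sum_eq_multiset_sum]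
  exact Finset.sum_congr rfl fun x _ => (vonNeumannEntropy_eq_sum_roots_charpoly (hτ x)).symm

/-- **Entropy of a matrix that does not couple different fibres of a labelling** `f : n → X`:
if `ρ_{ij} = 0` whenever `f i ≠ f j` (`ρ` Hermitian), then `S(ρ) = Σ_x S(ρ|_{f = x})`.
(Reindex along `Equiv.sigmaFiberEquiv f`: `ρ ≃ ⊕_x ρ|_{f = x}`.) [cite: NielsenChuang2010, §11.3.5 eq. (11.83) p.517] -/
theorem vonNeumannEntropy_eq_sum_fibers (f : n → X) {ρ : Matrix n n ℂ} (hρ : ρ.IsHermitian)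
    (hsupp : ∀ i j, f i ≠ f j → ρ i j = 0) :
    vonNeumannEntropy ρ =
      ∑ x, vonNeumannEntropy (ρ.submatrix (Subtype.val : {i // f i = x} → n) Subtype.val) := by
  set e := Equiv.sigmaFiberEquiv f with he
  have hblock : ρ.submatrix e e =
      blockDiagonal' (fun x => ρ.submatrix (Subtype.val : {i // f i = x} → n) Subtype.val) := by
    refine Matrix.ext fun a b => ?_
    obtain ⟨x, i⟩ := a
    obtain ⟨y, j⟩ := b
    by_cases hxy : x = y
    · subst hxy
      rw [blockDiagonal'_apply_eq, submatrix_apply, submatrix_apply]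
      rfl
    · rw [blockDiagonal'_apply_ne _ _ _ hxy, submatrix_apply]
      exact hsupp _ _ (fun h => hxy (i.2.symm.trans (h.trans j.2)))
  rw [← vonNeumannEntropy_submatrix_equiv hρ e, hblock, vonNeumannEntropy_blockDiagonal' fun x => hρ.submatrix _]

end Fibers

/-! ### §3 Mixtures of states with label-separated (orthogonal) supports -/

section Orthogonal

variable {n : Type*} [Fintype n] [DecidableEq n] {X : Type*} [Fintype X] [DecidableEq X]

/-- **`S(Σ_x τ_x) = Σ_x S(τ_x)`** for Hermitian `τ_x` supported on the fibre `{f = x}` of a labelling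
(rows AND columns): the summands live on pairwise orthogonal coordinate subspaces.
[cite: NielsenChuang2010, §11.3.5 eq. (11.83) p.517] -/
theorem vonNeumannEntropy_sum_of_orthogonalSupports (f : n → X) {τ : X → Matrix n n ℂ}
    (hτ : ∀ x, (τ x).IsHermitian) (hsupp : ∀ x i j, ¬ (f i = x ∧ f j = x) → τ x i j = 0) :
    vonNeumannEntropy (∑ x, τ x) = ∑ x, vonNeumannEntropy (τ x) := by
  have hρ : (∑ x, τ x).IsHermitian := by
    unfold Matrix.IsHermitian
    rw [Matrix.conjTranspose_sum]
    exact Finset.sum_congr rfl fun x _ => (hτ x).eq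
  have hsupp' : ∀ i j, f i ≠ f j → (∑ x, τ x) i j = 0 := by
    intro i j hij
    rw [Matrix.sum_apply]
    exact Finset.sum_eq_zero fun x _ => hsupp x i j (fun h => hij (h.1.trans h.2.symm))
  rw [vonNeumannEntropy_eq_sum_fibers f hρ hsupp']
  refine Finset.sum_congr rfl fun x _ => ?_
  have hbx : (∑ y, τ y).submatrix (Subtype.val : {i // f i = x} → n) (Subtype.val : {i // f i = x} → n) =
      (τ x).submatrix (Subtype.val : {i // f i = x} → n) (Subtype.val : {i // f i = x} → n) := by
    ext i j
    simp only [submatrix_apply, Matrix.sum_apply]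
    rw [Finset.sum_eq_single x]
    · intro y _ hyx
      exact hsupp y _ _ (fun h => hyx (h.1.symm.trans i.2))
    · intro hx
      exact absurd (Finset.mem_univ x) hx
  rw [hbx]
  exact (vonNeumannEntropy_eq_submatrix_of_support (fun i => f i = x) (hτ x)
    (fun i j hj => hsupp x i j (fun h => hj h.2))).symm

/-- **Weighted orthogonal mixtures**: for density matrices `ρ_x` (`tr ρ_x = 1`) supported on the fibre
`{f = x}` and real weights `p_x`, `S(Σ_x p_x ρ_x) = Σ_x (p_x S(ρ_x) + η(p_x))`, `η(t) = −t log t`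
(`= H(p) + Σ_x p_x S(ρ_x)` for a probability vector). [cite: NielsenChuang2010, §11.3.5 eq. (11.83) p.517] -/
theorem vonNeumannEntropy_sum_smul_of_orthogonalSupports (f : n → X) {ρ : X → Matrix n n ℂ}
    (hρ : ∀ x, (ρ x).IsHermitian) (htr : ∀ x, (ρ x).trace = 1)
    (hsupp : ∀ x i j, ¬ (f i = x ∧ f j = x) → ρ x i j = 0) (p : X → ℝ) :
    vonNeumannEntropy (∑ x, ((p x : ℝ) : ℂ) • ρ x) =
      ∑ x, (p x * vonNeumannEntropy (ρ x) + Real.negMulLog (p x)) := by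
  have hτ : ∀ x, (((p x : ℝ) : ℂ) • ρ x).IsHermitian := fun x => by
    unfold Matrix.IsHermitian
    rw [Matrix.conjTranspose_smul, (hρ x).eq, Complex.star_def, Complex.conj_ofReal]
  rw [vonNeumannEntropy_sum_of_orthogonalSupports f hτ
    (fun x i j h => by rw [Matrix.smul_apply, hsupp x i j h, smul_zero])]
  refine Finset.sum_congr rfl fun x _ => ?_
  rw [vonNeumannEntropy_smul (hρ x) (p x), htr x, Complex.one_re, mul_one]

/-- **The uniform mixture over a finite set of labels**: for density matrices `ρ_x` supported on the
fibres `{f = x}`, `x ∈ T` (`T` nonempty),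
`S((1/|T|) Σ_{x ∈ T} ρ_x) = (Σ_{x ∈ T} S(ρ_x))/|T| + log |T|` — the mixing entropy `log |T|` of a
uniform mixture of mutually orthogonal states (a TYPE CLASS of product trial states).
[cite: NielsenChuang2010, §11.3.5 eq. (11.83) p.517] -/
theorem vonNeumannEntropy_uniformMixture_of_orthogonalSupports (f : n → X) (T : Finset X)
    (hT : T.Nonempty) {ρ : X → Matrix n n ℂ} (hρ : ∀ x ∈ T, (ρ x).IsHermitian)
    (htr : ∀ x ∈ T, (ρ x).trace = 1) (hsupp : ∀ x ∈ T, ∀ i j, ¬ (f i = x ∧ f j = x) → ρ x i j = 0) :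
    vonNeumannEntropy (∑ x ∈ T, (((1 : ℝ) / T.card : ℝ) : ℂ) • ρ x) =
      (∑ x ∈ T, vonNeumannEntropy (ρ x)) / T.card + Real.log T.card := by
  classical
  have hM : (0 : ℝ) < T.card := by exact_mod_cast hT.card_pos
  -- zero outside `T`
  set τ : X → Matrix n n ℂ := fun x => if x ∈ T then (((1 : ℝ) / T.card : ℝ) : ℂ) • ρ x else 0 with hτdef
  have hsum : ∑ x ∈ T, (((1 : ℝ) / T.card : ℝ) : ℂ) • ρ x = ∑ x, τ x := by
    rw [← Finset.sum_subset (Finset.subset_univ T) (fun x _ hx => by rw [hτdef]; dsimp only; rw [if_neg hx])]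
    exact Finset.sum_congr rfl fun x hx => by rw [hτdef]; dsimp only; rw [if_pos hx]
  have hτh : ∀ x, (τ x).IsHermitian := by
    intro x
    rw [hτdef]; dsimp only
    split_ifs with hx
    · unfold Matrix.IsHermitian
      rw [Matrix.conjTranspose_smul, (hρ x hx).eq, Complex.star_def, Complex.conj_ofReal]
    · exact Matrix.isHermitian_zero
  have hτs : ∀ x i j, ¬ (f i = x ∧ f j = x) → τ x i j = 0 := by
    intro x i j h
    rw [hτdef]; dsimp only
    split_ifs with hx
    · rw [Matrix.smul_apply, hsupp x hx i j h, smul_zero]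
    · rfl
  rw [hsum, vonNeumannEntropy_sum_of_orthogonalSupports f hτh hτs]
  have hterm : ∀ x, vonNeumannEntropy (τ x) =
      if x ∈ T then (1 / (T.card : ℝ)) * vonNeumannEntropy (ρ x) + Real.negMulLog (1 / (T.card : ℝ)) else 0 := by
    intro x
    rw [hτdef]; dsimp only
    split_ifs with hx
    · rw [vonNeumannEntropy_smul (hρ x hx), htr x hx, Complex.one_re, mul_one]
    · exact vonNeumannEntropy_zero
  simp_rw [hterm]
  rw [← Finset.sum_filter, Finset.filter_mem_eq_inter, Finset.univ_inter, Finset.sum_add_distrib,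
    Finset.sum_const, nsmul_eq_mul, ← Finset.mul_sum]
  have hη : Real.negMulLog (1 / (T.card : ℝ)) = Real.log (T.card : ℝ) / T.card := by
    rw [Real.negMulLog, one_div, Real.log_inv]
    ring
  rw [hη]
  field_simp

end Orthogonal

/-! ### §4 Finitely many labels out of an arbitrary label type (append 2026-08-27, hubbard-thermal-p1 g6)

For the sector labelling of a Fock space the label type (`ℕ × ℕ`) is infinite; only the finitely many labels
carried by the mixture matter. -/

section FinsetLabels

variable {n : Type*} [Fintype n] [DecidableEq n] {X : Type*} [DecidableEq X]

/-- **Weighted orthogonal mixtures over a finite set of labels of an arbitrary label type**: for a labelling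
`f : n → X`, a finite set `T` of labels, density matrices `ρ_x` (`x ∈ T`, `tr ρ_x = 1`) supported on the fibres
`{f = x}`, and real weights `p_x`:  `S(Σ_{x∈T} p_x ρ_x) = Σ_{x∈T} (p_x S(ρ_x) + η(p_x))`
(`= H(p) + Σ p_x S(ρ_x)` for a probability vector on `T`). [cite: NielsenChuang2010, §11.3.5 eq. (11.83) p.517] -/
theorem vonNeumannEntropy_finsetSum_smul_of_orthogonalSupports (f : n → X) (T : Finset X)
    {ρ : X → Matrix n n ℂ} (hρ : ∀ x ∈ T, (ρ x).IsHermitian) (htr : ∀ x ∈ T, (ρ x).trace = 1)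
    (hsupp : ∀ x ∈ T, ∀ i j, ¬ (f i = x ∧ f j = x) → ρ x i j = 0) (p : X → ℝ) :
    vonNeumannEntropy (∑ x ∈ T, ((p x : ℝ) : ℂ) • ρ x) =
      ∑ x ∈ T, (p x * vonNeumannEntropy (ρ x) + Real.negMulLog (p x)) := by
  classical
  -- finite label type: `Option T` (the fibres outside `T` are sent to `none`, which carries the zero matrix)
  let f' : n → Option T := fun i => if h : f i ∈ T then some ⟨f i, h⟩ else none
  let τ : Option T → Matrix n n ℂ := fun o => match o with
    | none => 0
    | some x => ((p x : ℝ) : ℂ) • ρ x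
  have hτh : ∀ o, (τ o).IsHermitian := by
    rintro (_ | x)
    · exact Matrix.isHermitian_zero
    · change (((p x : ℝ) : ℂ) • ρ x).IsHermitian
      unfold Matrix.IsHermitian
      rw [Matrix.conjTranspose_smul, (hρ x x.2).eq, Complex.star_def, Complex.conj_ofReal]
  have hτs : ∀ o i j, ¬ (f' i = o ∧ f' j = o) → τ o i j = 0 := by
    rintro (_ | x) i j h
    · rfl
    · change (((p x : ℝ) : ℂ) • ρ x) i j = 0
      rw [Matrix.smul_apply, hsupp x x.2 i j ?_, smul_zero]
      rintro ⟨hi, hj⟩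
      apply h
      constructor
      · show (if h : f i ∈ T then some ⟨f i, h⟩ else none) = some x
        rw [dif_pos (hi ▸ x.2)]
        exact congrArg some (Subtype.ext hi)
      · show (if h : f j ∈ T then some ⟨f j, h⟩ else none) = some x
        rw [dif_pos (hj ▸ x.2)]
        exact congrArg some (Subtype.ext hj)
  have hsum : ∑ x ∈ T, ((p x : ℝ) : ℂ) • ρ x = ∑ o, τ o := by
    rw [Fintype.sum_option]
    change _ = 0 + ∑ x : T, ((p x : ℝ) : ℂ) • ρ x
    rw [zero_add, Finset.sum_coe_sort T (fun x => ((p x : ℝ) : ℂ) • ρ x)]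
  rw [hsum, vonNeumannEntropy_sum_of_orthogonalSupports f' hτh hτs, Fintype.sum_option]
  change vonNeumannEntropy (0 : Matrix n n ℂ) + ∑ x : T, vonNeumannEntropy (((p x : ℝ) : ℂ) • ρ x) = _
  rw [vonNeumannEntropy_zero, zero_add,
    Finset.sum_coe_sort T (fun x => vonNeumannEntropy (((p x : ℝ) : ℂ) • ρ x))]
  refine Finset.sum_congr rfl fun x hx => ?_
  rw [vonNeumannEntropy_smul (hρ x hx) (p x), htr x hx, Complex.one_re, mul_one]

end FinsetLabels

end Literature.InformationTheory.Entropy
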